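import Mathlib
import Literature.Analysis.FluidPDE.CompressibleEulerImplosionOriginSeries
import HarnessLib

/-!
# Buckmaster–Cao-Labora–Gómez-Serrano at `γ = 5/3`: the centre series on a disc of known radius

Companion of `CompressibleEulerImplosionOriginSeries` (Prop. 2.5, first half: the power series
`𝒲(ζ) = Σ wᵢ ζⁱ` of the profile at `ζ = 0`). The tree proves convergence, termwise differentiation and
the profile equation (1.10) only inside the crude Catalan radius `rad r A = 1/(2M₀)`. This file
re-derives the same package on ANY disc on which a geometric coefficient bound is available — the
input form produced by kernel-certified majorants (`…OriginSeriesGrowth`: `|wⱼ| ≤ (73/25)ʲ` on the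
shooting window of the pinned profile):

* `hasSum_profile_of_bound`, `analyticAt_profile_of_bound` — `|wₙ| ≤ K μⁿ` gives the power series and
  analyticity of `profile r A` on `μ|ζ| < 1`;
* `profile_eq_of_bound` — the profile equation (1.10) on `0 < μ|ζ| < 1` (identity theorem: the
  analytic defect vanishes near `0` by the tree's `profile_eq`);
* the exponential substitution `ζ = c eˣ` used by the centre expansion of the pinned profile:
  `xSeries a c x = Σ aₖ (c eˣ)ᵏ` with `|aₖ| ≤ K (k+1)ᵖ μᵏ` has `HasSum`, and its first and second
  `x`-derivatives are the series with coefficients `k aₖ`, `k² aₖ` (`hasSum_deriv_xSeries`,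
  `hasSum_deriv2_xSeries`) on `μ c eˣ < 1`.

[cite: BuckmasterCaolaboraGomezserrano2025, Prop. 2.5, eq. (1.10), (2.11)–(2.12)]
-/

noncomputable section

open Filter Set Metric Topology

namespace Literature.Analysis.FluidPDE

namespace BuckmasterCaolaboraGomezserrano2025

namespace OriginSeries

/-! ### Weighted geometric summability -/

/-- `Σ (k+1)ᵐ θᵏ < ∞` for `0 < θ < 1`. [folklore] -/
theorem summable_succ_pow_mul_geometric (m : ℕ) {θ : ℝ} (h0 : 0 < θ) (h1 : θ < 1) :
    Summable (fun k : ℕ => ((k : ℝ) + 1) ^ m * θ ^ k) := by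
  have hb : Summable (fun n : ℕ => (n : ℝ) ^ m * θ ^ n) :=
    summable_pow_mul_geometric_of_norm_lt_one m (by rwa [Real.norm_of_nonneg h0.le])
  have hs := ((summable_nat_add_iff 1).mpr hb).mul_left θ⁻¹
  refine hs.congr fun k => ?_
  show θ⁻¹ * (((k + 1 : ℕ) : ℝ) ^ m * θ ^ (k + 1)) = ((k : ℝ) + 1) ^ m * θ ^ k
  push_cast
  rw [pow_succ]
  field_simp

/-! ### The exponential-substituted series `Σ aₖ (c eˣ)ᵏ` -/

/-- `xSeries a c x = Σ aₖ (c eˣ)ᵏ`: a power series in `ζ = c eˣ` read as a function of `x`. [folklore] -/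
def xSeries (a : ℕ → ℝ) (c x : ℝ) : ℝ := ∑' k, a k * (c * Real.exp x) ^ k

section XSeries

variable {a : ℕ → ℝ} {K μ c : ℝ} {p : ℕ}

/-- [folklore] -/
theorem K_nonneg_of_bound (hK : ∀ k, |a k| ≤ K * ((k : ℝ) + 1) ^ p * μ ^ k) : 0 ≤ K := by
  have := (abs_nonneg (a 0)).trans (hK 0)
  simpa using this

/-- Weighted term bound: `(k+1)^q |aₖ tᵏ| ≤ K (k+1)^{p+q} (μt)ᵏ`. [folklore] -/
theorem weight_abs_term_le (hK : ∀ k, |a k| ≤ K * ((k : ℝ) + 1) ^ p * μ ^ k) {t : ℝ} (ht : 0 ≤ t)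
    (k q : ℕ) : ((k : ℝ) + 1) ^ q * |a k * t ^ k| ≤ K * (((k : ℝ) + 1) ^ (p + q) * (μ * t) ^ k) := by
  rw [abs_mul, abs_pow, abs_of_nonneg ht, mul_pow, pow_add]
  have h := hK k
  calc ((k : ℝ) + 1) ^ q * (|a k| * t ^ k) ≤ ((k : ℝ) + 1) ^ q * ((K * ((k : ℝ) + 1) ^ p * μ ^ k) * t ^ k) := by
        gcongr
    _ = _ := by ring

/-- Weighted absolute summability on `μ t < 1`. [folklore] -/
theorem summable_weight_abs (hK : ∀ k, |a k| ≤ K * ((k : ℝ) + 1) ^ p * μ ^ k) (hμ : 0 < μ) {t : ℝ}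
    (ht : 0 < t) (hμt : μ * t < 1) (q : ℕ) : Summable (fun k : ℕ => ((k : ℝ) + 1) ^ q * |a k * t ^ k|) := by
  refine Summable.of_nonneg_of_le (fun k => by positivity) (fun k => weight_abs_term_le hK ht.le k q) ?_
  exact (summable_succ_pow_mul_geometric (p + q) (by positivity) hμt).mul_left K

/-- `HasSum (aₖ (c eˣ)ᵏ) (xSeries a c x)` on `μ c eˣ < 1`. [folklore] -/
theorem hasSum_xSeries (hK : ∀ k, |a k| ≤ K * ((k : ℝ) + 1) ^ p * μ ^ k) (hμ : 0 < μ) (hc : 0 < c)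
    {x : ℝ} (hx : μ * (c * Real.exp x) < 1) :
    HasSum (fun k => a k * (c * Real.exp x) ^ k) (xSeries a c x) := by
  have hs := summable_weight_abs hK hμ (by positivity : 0 < c * Real.exp x) hx 0
  simp only [pow_zero, one_mul] at hs
  unfold xSeries
  exact hs.of_abs.hasSum

/-- Comparison of sums: `|Σ fₖ| ≤ Σ gₖ` when `|fₖ| ≤ gₖ`. [folklore] -/
theorem abs_le_of_hasSum_le {f g : ℕ → ℝ} {s t : ℝ} (hf : HasSum f s) (hg : HasSum g t)
    (h : ∀ k, |f k| ≤ g k) : |s| ≤ t := by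
  have := hf.norm_le_of_bounded hg (fun k => by rw [Real.norm_eq_abs]; exact h k)
  rwa [Real.norm_eq_abs] at this

/-- **Termwise differentiation in `x`**: `d/dx Σ aₖ (c eˣ)ᵏ = Σ k aₖ (c eˣ)ᵏ` on `μ c eˣ < 1`. [folklore] -/
theorem hasDerivAt_xSeries (hK : ∀ k, |a k| ≤ K * ((k : ℝ) + 1) ^ p * μ ^ k) (hμ : 0 < μ) (hc : 0 < c)
    {x : ℝ} (hx : μ * (c * Real.exp x) < 1) :
    HasDerivAt (xSeries a c) (∑' k : ℕ, (k : ℝ) * a k * (c * Real.exp x) ^ k) x := by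
  have hKnn := K_nonneg_of_bound hK
  have hμc : 0 < μ * c := by positivity
  -- the open interval `(-∞, x₁)` with `x < x₁ < log(1/(μc))`
  set L : ℝ := Real.log (1 / (μ * c)) with hL
  have hxL : x < L := by
    rw [hL, Real.lt_log_iff_exp_lt (by positivity), lt_div_iff₀ hμc]
    nlinarith
  set x₁ : ℝ := (x + L) / 2 with hx₁
  have hx1 : x < x₁ := by rw [hx₁]; linarith
  have hx1L : x₁ < L := by rw [hx₁]; linarith
  set ρ : ℝ := c * Real.exp x₁ with hρ
  have hρ0 : 0 < ρ := by positivity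
  have hμρ : μ * ρ < 1 := by
    have h1 : Real.exp x₁ < 1 / (μ * c) := by
      rwa [hL, Real.lt_log_iff_exp_lt (by positivity)] at hx1L
    rw [lt_div_iff₀ hμc] at h1
    rw [hρ]; nlinarith
  -- the dominating sequence
  set u : ℕ → ℝ := fun k : ℕ => K * (((k : ℝ) + 1) ^ (p + 1) * (μ * ρ) ^ k) with hu
  have hu_sum : Summable u := (summable_succ_pow_mul_geometric (p + 1) (by positivity) hμρ).mul_left K
  set g : ℕ → ℝ → ℝ := fun k y => a k * (c * Real.exp y) ^ k with hg
  set g' : ℕ → ℝ → ℝ := fun k y => (k : ℝ) * a k * (c * Real.exp y) ^ k with hg'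
  have hderiv : ∀ (k : ℕ) (y : ℝ), y ∈ Set.Iio x₁ → HasDerivAt (g k) (g' k y) y := by
    intro k y _
    have h1 : HasDerivAt (fun y => c * Real.exp y) (c * Real.exp y) y := (Real.hasDerivAt_exp y).const_mul c
    have h2 := (h1.fun_pow k).const_mul (a k)
    simp only [hg, hg']
    refine h2.congr_deriv ?_
    rcases k with _ | k
    · simp
    · push_cast
      rw [pow_succ]
      ring
  have hbound : ∀ (k : ℕ) (y : ℝ), y ∈ Set.Iio x₁ → ‖g' k y‖ ≤ u k := by
    intro k y hy
    have hy' : c * Real.exp y ≤ ρ := by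
      rw [hρ]; gcongr; exact le_of_lt hy
    have ht0 : 0 ≤ c * Real.exp y := by positivity
    rw [Real.norm_eq_abs]
    simp only [hg', hu]
    rw [abs_mul, abs_mul, abs_of_nonneg (by positivity : (0 : ℝ) ≤ k), abs_pow, abs_of_nonneg ht0]
    have hk1 : (k : ℝ) ≤ (k : ℝ) + 1 := by linarith
    have hak := hK k
    calc (k : ℝ) * |a k| * (c * Real.exp y) ^ k ≤ ((k : ℝ) + 1) * (K * ((k : ℝ) + 1) ^ p * μ ^ k) * ρ ^ k := by
          gcongr
      _ = K * (((k : ℝ) + 1) ^ (p + 1) * (μ * ρ) ^ k) := by rw [mul_pow]; ring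
  have hmem : x ∈ Set.Iio x₁ := hx1
  have hsum0 : Summable fun k => g k x := by
    have hs := summable_weight_abs hK hμ (by positivity : 0 < c * Real.exp x) hx 0
    simp only [pow_zero, one_mul] at hs
    exact hs.of_abs
  have key := hasDerivAt_tsum_of_isPreconnected hu_sum isOpen_Iio isPreconnected_Iio hderiv hbound hmem hsum0 hmem
  exact key

/-- `HasSum (k aₖ (c eˣ)ᵏ) (d/dx xSeries a c x)` on `μ c eˣ < 1`. [folklore] -/
theorem hasSum_deriv_xSeries (hK : ∀ k, |a k| ≤ K * ((k : ℝ) + 1) ^ p * μ ^ k) (hμ : 0 < μ) (hc : 0 < c)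
    {x : ℝ} (hx : μ * (c * Real.exp x) < 1) :
    HasSum (fun k : ℕ => (k : ℝ) * a k * (c * Real.exp x) ^ k) (deriv (xSeries a c) x) := by
  rw [(hasDerivAt_xSeries hK hμ hc hx).deriv]
  have hs := summable_weight_abs hK hμ (by positivity : 0 < c * Real.exp x) hx 1
  have hs' : Summable fun k : ℕ => |(k : ℝ) * a k * (c * Real.exp x) ^ k| := by
    refine Summable.of_nonneg_of_le (fun k => abs_nonneg _) (fun k => ?_) hs
    rw [pow_one, mul_assoc, abs_mul, abs_of_nonneg (by positivity : (0 : ℝ) ≤ k)]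
    have hk1 : (k : ℝ) ≤ (k : ℝ) + 1 := by linarith
    exact mul_le_mul_of_nonneg_right hk1 (abs_nonneg _)
  exact hs'.of_abs.hasSum

/-- The coefficient class is stable under `aₖ ↦ k aₖ` (one more power of `k + 1`). [folklore] -/
theorem bound_mul_index (hK : ∀ k, |a k| ≤ K * ((k : ℝ) + 1) ^ p * μ ^ k) :
    ∀ k : ℕ, |(k : ℝ) * a k| ≤ K * ((k : ℝ) + 1) ^ (p + 1) * μ ^ k := by
  intro k
  have hKnn := K_nonneg_of_bound hK
  have hk1 : (k : ℝ) ≤ (k : ℝ) + 1 := by linarith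
  have h := hK k
  have hμk : 0 ≤ K * ((k : ℝ) + 1) ^ p * μ ^ k := (abs_nonneg _).trans h
  rw [abs_mul, abs_of_nonneg (by positivity : (0 : ℝ) ≤ k), pow_succ]
  calc (k : ℝ) * |a k| ≤ ((k : ℝ) + 1) * (K * ((k : ℝ) + 1) ^ p * μ ^ k) := by gcongr
    _ = _ := by ring

/-- On `μ c eˣ < 1` the derivative of `xSeries a c` is the `xSeries` of `k aₖ`. [folklore] -/
theorem deriv_xSeries_eq (hK : ∀ k, |a k| ≤ K * ((k : ℝ) + 1) ^ p * μ ^ k) (hμ : 0 < μ) (hc : 0 < c)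
    {x : ℝ} (hx : μ * (c * Real.exp x) < 1) :
    deriv (xSeries a c) x = xSeries (fun k : ℕ => (k : ℝ) * a k) c x := by
  rw [← (hasSum_deriv_xSeries hK hμ hc hx).tsum_eq]
  rfl

/-- **Second termwise derivative in `x`**: `d²/dx² Σ aₖ (c eˣ)ᵏ = Σ k² aₖ (c eˣ)ᵏ` on `μ c eˣ < 1`. [folklore] -/
theorem hasSum_deriv2_xSeries (hK : ∀ k, |a k| ≤ K * ((k : ℝ) + 1) ^ p * μ ^ k) (hμ : 0 < μ) (hc : 0 < c)
    {x : ℝ} (hx : μ * (c * Real.exp x) < 1) :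
    HasSum (fun k : ℕ => (k : ℝ) ^ 2 * a k * (c * Real.exp x) ^ k) (deriv (deriv (xSeries a c)) x) := by
  have hK' := bound_mul_index hK
  have hopen : IsOpen {y : ℝ | μ * (c * Real.exp y) < 1} :=
    isOpen_lt (continuous_const.mul (continuous_const.mul Real.continuous_exp)) continuous_const
  have hev : deriv (xSeries a c) =ᶠ[𝓝 x] xSeries (fun k : ℕ => (k : ℝ) * a k) c := by
    filter_upwards [hopen.mem_nhds hx] with y hy
    exact deriv_xSeries_eq hK hμ hc hy
  rw [hev.deriv_eq]
  have h2 := hasSum_deriv_xSeries hK' hμ hc hx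
  convert h2 using 1
  funext k
  ring

end XSeries

/-! ### The profile on a disc of known radius -/

section Profile

variable {r A K μ : ℝ}

/-- `HasSum (wₙ ζⁿ) (𝒲 ζ)` on `μ|ζ| < 1` from `|wₙ| ≤ K μⁿ`. [cite: BuckmasterCaolaboraGomezserrano2025, Prop. 2.5] -/
theorem hasSum_profile_of_bound (hμ : 0 < μ) (hKw : ∀ n, |w r A n| ≤ K * μ ^ n) {ζ : ℝ} (hζ : μ * |ζ| < 1) :
    HasSum (fun n => w r A n * ζ ^ n) (profile r A ζ) := by
  have hKnn : 0 ≤ K := by have := (abs_nonneg _).trans (hKw 0); simpa using this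
  have hs : Summable fun n => |w r A n * ζ ^ n| := by
    refine Summable.of_nonneg_of_le (fun n => abs_nonneg _) (fun n => ?_)
      ((summable_geometric_of_lt_one (by positivity) hζ).mul_left K)
    rw [abs_mul, abs_pow, mul_pow]
    calc |w r A n| * |ζ| ^ n ≤ K * μ ^ n * |ζ| ^ n := by gcongr; exact hKw n
      _ = K * (μ ^ n * |ζ| ^ n) := by ring
  unfold profile
  exact hs.of_abs.hasSum

/-- **Analyticity on the disc**: `𝒲` is analytic at every `ζ` with `μ|ζ| < 1`.
[cite: BuckmasterCaolaboraGomezserrano2025, Prop. 2.5] -/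
theorem analyticAt_profile_of_bound (hμ : 0 < μ) (hKw : ∀ n, |w r A n| ≤ K * μ ^ n) {ζ : ℝ} (hζ : μ * |ζ| < 1) :
    AnalyticAt ℝ (profile r A) ζ := by
  -- adapted from `analyticAt_profile` (radius `1/M₀` replaced by `1/μ`)
  have hKnn : 0 ≤ K := by have := (abs_nonneg _).trans (hKw 0); simpa using this
  set q := FormalMultilinearSeries.ofScalars ℝ (w r A) with hq
  let Minv : NNReal := ⟨μ⁻¹, inv_nonneg.mpr hμ.le⟩
  have hrad : ((Minv : NNReal) : ENNReal) ≤ q.radius := by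
    refine q.le_radius_of_bound K fun n => ?_
    rw [hq, FormalMultilinearSeries.ofScalars_norm, Real.norm_eq_abs]
    show |w r A n| * (μ⁻¹) ^ n ≤ K
    calc |w r A n| * (μ⁻¹) ^ n ≤ K * μ ^ n * (μ⁻¹) ^ n := by
          gcongr; exact hKw n
      _ = K := by rw [mul_assoc, ← mul_pow, mul_inv_cancel₀ hμ.ne', one_pow, mul_one]
  have hMinv_pos : (0 : ENNReal) < ((Minv : NNReal) : ENNReal) := by
    have : (0 : NNReal) < Minv := by
      show (0 : ℝ) < μ⁻¹
      exact inv_pos.mpr hμ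
    exact_mod_cast this
  have hps : HasFPowerSeriesOnBall q.sum q 0 ((Minv : NNReal) : ENNReal) :=
    (q.hasFPowerSeriesOnBall (hMinv_pos.trans_le hrad)).mono hMinv_pos hrad
  have hfun : q.sum = profile r A := by
    show FormalMultilinearSeries.ofScalarsSum (E := ℝ) (w r A) = profile r A
    rw [FormalMultilinearSeries.ofScalarsSum_eq_tsum]
    funext x
    simp [profile, smul_eq_mul]
  rw [← hfun]
  refine hps.analyticAt_of_mem ?_
  rw [Metric.eball_coe, Metric.mem_ball, Real.dist_eq, sub_zero]
  show |ζ| < μ⁻¹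
  calc |ζ| = μ * |ζ| / μ := by field_simp
    _ < 1 / μ := div_lt_div_of_pos_right hζ hμ
    _ = μ⁻¹ := one_div μ

/-- **The profile equation (1.10) on the disc `0 < μ|ζ| < 1`** (identity theorem: the analytic defect of
(1.10), multiplied by `ζ`, vanishes near `0` by `profile_eq`). [cite: BuckmasterCaolaboraGomezserrano2025, Prop. 2.5] -/
theorem profile_eq_of_bound (hA : A ≠ 0) (hμ : 0 < μ) (hKw : ∀ n, |w r A n| ≤ K * μ ^ n) {ζ : ℝ}
    (hζ0 : ζ ≠ 0) (hζ : μ * |ζ| < 1) :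
    (r - 1) * profile r A ζ
        + (ζ + 1 / 2 * (profile r A ζ - profile r A (-ζ)
            + 1 / 3 * (profile r A ζ + profile r A (-ζ)))) * deriv (profile r A) ζ
        + 1 / 3 / (2 * ζ) * (profile r A ζ ^ 2 - profile r A (-ζ) ^ 2) = 0 := by
  -- the analytic defect
  set F : ℝ → ℝ := fun y => y * ((r - 1) * profile r A y
      + (y + 1 / 2 * (profile r A y - profile r A (-y) + 1 / 3 * (profile r A y + profile r A (-y))))
        * deriv (profile r A) y) + 1 / 6 * (profile r A y ^ 2 - profile r A (-y) ^ 2) with hF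
  have hball : ∀ y ∈ Metric.ball (0 : ℝ) μ⁻¹, μ * |y| < 1 := by
    intro y hy
    rw [Metric.mem_ball, Real.dist_eq, sub_zero] at hy
    calc μ * |y| < μ * μ⁻¹ := mul_lt_mul_of_pos_left hy hμ
      _ = 1 := mul_inv_cancel₀ hμ.ne'
  have hFa : AnalyticOnNhd ℝ F (Metric.ball (0 : ℝ) μ⁻¹) := by
    intro y hy
    have hy' := hball y hy
    have hP1 : AnalyticAt ℝ (profile r A) y := analyticAt_profile_of_bound hμ hKw hy'
    have hQ1 : AnalyticAt ℝ (fun z => profile r A (-z)) y :=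
      (analyticAt_profile_of_bound hμ hKw (ζ := -y) (by simpa using hy')).comp analyticAt_id.neg
    have hD : AnalyticAt ℝ (deriv (profile r A)) y := hP1.deriv
    have hid : AnalyticAt ℝ (fun z : ℝ => z) y := analyticAt_id
    simp only [hF]
    exact (hid.mul ((analyticAt_const.mul hP1).add ((hid.add (analyticAt_const.mul ((hP1.sub hQ1).add
      (analyticAt_const.mul (hP1.add hQ1))))).mul hD))).add (analyticAt_const.mul ((hP1.pow 2).sub (hQ1.pow 2)))
  -- `F = ζ · (defect of (1.10))` off `0`
  have hFE : ∀ y : ℝ, y ≠ 0 → F y = y * ((r - 1) * profile r A y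
      + (y + 1 / 2 * (profile r A y - profile r A (-y) + 1 / 3 * (profile r A y + profile r A (-y))))
        * deriv (profile r A) y + 1 / 3 / (2 * y) * (profile r A y ^ 2 - profile r A (-y) ^ 2)) := by
    intro y hy
    simp only [hF]
    field_simp
    ring
  -- `F` vanishes near `0` by the tree's `profile_eq`
  have hF0 : F =ᶠ[𝓝 (0 : ℝ)] 0 := by
    filter_upwards [Metric.ball_mem_nhds (0 : ℝ) (rad_pos (r := r) (A := A))] with y hy
    rw [Metric.mem_ball, Real.dist_eq, sub_zero] at hy
    by_cases hy0 : y = 0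
    · subst hy0; simp [hF]
    · rw [Pi.zero_apply, hFE y hy0, profile_eq hA hy0 hy, mul_zero]
  have hzero := hFa.eqOn_zero_of_preconnected_of_eventuallyEq_zero (convex_ball (0 : ℝ) μ⁻¹).isPreconnected
    (Metric.mem_ball_self (inv_pos.mpr hμ)) hF0
  have hζball : ζ ∈ Metric.ball (0 : ℝ) μ⁻¹ := by
    rw [Metric.mem_ball, Real.dist_eq, sub_zero]
    calc |ζ| = μ * |ζ| / μ := by field_simp
      _ < 1 / μ := div_lt_div_of_pos_right hζ hμ
      _ = μ⁻¹ := one_div μ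
  have hFζ : F ζ = 0 := hzero hζball
  rw [hFE ζ hζ0] at hFζ
  rcases mul_eq_zero.mp hFζ with h | h
  · exact absurd h hζ0
  · exact h

end Profile

end OriginSeries

end BuckmasterCaolaboraGomezserrano2025

end Literature.Analysis.FluidPDE
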